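import Literature.NumberTheory.EllipticCurves.Greenberg1999.LocalQuotientControlSurjectiveProofs
import Literature.NumberTheory.GaloisRepresentations.HochschildSerreEdgeCoinvariants
import Literature.NumberTheory.GaloisRepresentations.PadicIntCdOne
import HarnessLib

set_option linter.dupNamespace false -- `…BirchSwinnertonDyer.BirchSwinnertonDyer…` is the cell's nested layout (D-0017)
set_option autoImplicit false

/-!
# Greenberg LNM 1716 p. 108 «for `v ∣ p`», step 2: `(E(K_{∞,η}) ⊗ ℚ_p/ℤ_p)_{Γ_η} = 0` from `H²(K_v, Ê[p^∞]) = 0`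
# and the Coates–Greenberg vanishing `H¹(K_{∞,η}, Ê(𝔪̄)) = 0` (the maps `λ_v`)

Seat `bsd-inputs-k4-p1` (gen 4; LADDER-BSD D-0154 KEY (147)(f) «prove the printed input», row 1 K4 INPUTS; Greenberg
1999), `--supports stmt-BirchSwinnertonDyer-20309`. THEOREMS ONLY (no definition, no named fact, no `sorry`).

The Literature theorem `Greenberg1999.exists_primary_resOfLe_eq_of_forall_conjH1_eq_of_coinv`
(`Greenberg1999/LocalQuotientControlSurjectiveCoinvProofs`) reduces Greenberg's local surjectivity
`𝒫_E(K_v)[p^∞] ↠ (𝒫_E(K_{∞,η})[p^∞])^{Γ}` (LNM 1716, §4 proof of Lemma 4.7, p. 108) at an arbitrary finite place to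
the element-wise hypothesis

  (H²) `∀ a ∈ M, ∀ k, ∃ j, m R ∈ M, t ∈ E(K̄_v)[p^∞]: p^j a = (g − 1) m + p^{k+j} R + t`, `M = E(K̄_v)^N`,

for the kernel `N` and a topological generator `g` of the local `ℤ_p`-extension — i.e. `(M ⊗ ℚ_p/ℤ_p)_{Γ_η} = 0`. This
file derives (H²) at a good ORDINARY place `v ∣ p` "looking at the maps `λ_v`" (Greenberg §2 pp. 70–75), in the
abstract `red₀`-currency of the tree's ordinary local files and for ANY local `ℤ_p`-extension `κE` of `K_v` with kernel
`N`, from THREE displayed inputs: (a) `H²(Γ_{K_v}, C) = 0` for `C = ker red₀ ∩ E(K̄_v)[p^∞] = Ê[p^∞]` (step 1,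
`InputsGreenbergLocalAtP.subsingleton_continuousCohomology_two_formalTorsion`); (b) the Coates–Greenberg vanishing
`H¹(N, Ê(𝔪̄)) = 0` in cocycle form (`hCG`; tree: `CoatesGreenberg1996.H1_goodModelKernel_trivial`, PROVED at universe
`0` — `H1_goodModelKernel_trivial_holds`); (c) `E(K̄_v)/E₁` torsion (`htor`; tree: `exists_nsmul_localRed_eq_zero`).

* §1 `coinvInput_of_nsmul_not_dvd`, `coinvInput_of_pow_nsmul` — bookkeeping: (H²) for `u • a` (`p ∤ u`) or for
  `p^s • a` at depth `k + s` gives (H²) for `a` at depth `k`.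
* §2 `coinvInput_of_mem_ker` — THE CORE, `a ∈ M ∩ ker red₀`: the Kummer cocycle `τ ↦ τ b − b` (`p^k b = a`, `b ∈ E₁`)
  is a class of `H¹(N, C)`; by Hochschild–Serre with `cd_p(Γ_{K_v}/N) = 1` and (a)
  (`exists_conjMap_sub_eq_of_resSubgroup_two_injective`) it is `g·ψ − ψ` up to a coboundary, for a `C`-valued cocycle
  `ψ` on `N`; by (b) `ψ = ∂e` with `e ∈ E₁`; unwinding, `b + c₀ − (g − 1) e ∈ M`, and multiplying by a large power of
  `p` gives `p^j a = (g − 1)(p^K e) + p^{k+j} R` with `p^K e ∈ M`.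
* §3 `coinvInput_of_formalH2_of_coatesGreenberg` — (H²) for every `a ∈ M` (§2 for a suitable multiple `n a ∈ E₁`,
  `n = p^s u`, then §1).

HONEST FRAMING: local TOOL theorems with displayed hypotheses (a)–(c); closes no item; no summit statement is proved; BSD
is not proved by any of this.

References: [GreenbergLNM1716] §2 Props. 2.1–2.4 (pp. 70–75), §4 p. 108; [CoatesGreenberg1996] Cor. 3.2, Prop. 4.3;
[NeukirchSchmidtWingberg2008] (2.4.1); [SerreLocalFields1979] XIII §1.
-/

noncomputable section

open scoped Classical NNReal

universe u

namespace Summit.BirchSwinnertonDyer.BirchSwinnertonDyer.Theorems.InputsGreenbergLocalAtP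

open CategoryTheory NumberField IsDedekindDomain Field _root_.TopRep _root_.ContinuousCohomology WeierstrassCurve
  Literature.NumberTheory.GaloisRepresentations Literature.NumberTheory.EllipticCurves
  Literature.NumberTheory.EllipticCurves.ZpExtension

variable {K : Type u} [Field K] [NumberField K] (v : HeightOneSpectrum (𝓞 K)) (W : WeierstrassCurve K) [W.IsElliptic]
  {p : ℕ} [hp : Fact p.Prime]

/-! ## §1 Bookkeeping for the hypothesis (H²) -/

omit [W.IsElliptic] in
/-- **(H²) descends along a prime-to-`p` multiple.** If `p ∤ u` and `p^j (u • a) = (g m − m) + p^{k+j} R + t` with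
`m, R` fixed by `N` and `t` `p`-power torsion, then the same holds for `a` (with the same `j`): invert `u` modulo
`p^{k+j+1}`. [cite: GreenbergLNM1716, §4 p. 108] -/
theorem coinvInput_of_nsmul_not_dvd (N : Subgroup (absoluteGaloisGroup (v.adicCompletion K)))
    (g : absoluteGaloisGroup (v.adicCompletion K)) (a : localPoints W (v.adicCompletion K)) (k : ℕ)
    {u : ℕ} (hu : ¬ p ∣ u)
    (h : ∃ (j : ℕ) (m R t : localPoints W (v.adicCompletion K)),
      (∀ τ ∈ N, τ • m = m) ∧ (∀ τ ∈ N, τ • R = R) ∧ (∃ e : ℕ, p ^ e • t = 0) ∧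
      p ^ j • (u • a) = (g • m - m) + p ^ (k + j) • R + t)
    (ha : ∀ τ ∈ N, τ • a = a) :
    ∃ (j : ℕ) (m R t : localPoints W (v.adicCompletion K)),
      (∀ τ ∈ N, τ • m = m) ∧ (∀ τ ∈ N, τ • R = R) ∧ (∃ e : ℕ, p ^ e • t = 0) ∧
      p ^ j • a = (g • m - m) + p ^ (k + j) • R + t := by
  obtain ⟨j, m, R, t, hm, hR, ⟨e, hte⟩, heq⟩ := h
  have galois_smul_nsmul : ∀ (τ : absoluteGaloisGroup (v.adicCompletion K)) (n : ℕ)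
      (P : localPoints W (v.adicCompletion K)), τ • (n • P) = n • (τ • P) :=
    fun τ n P ↦ map_nsmul (DistribSMul.toAddMonoidHom (localPoints W (v.adicCompletion K)) τ) n P
  -- `u u' = p^(k+j+1) c + 1`
  have hcop : Nat.Coprime u (p ^ (k + j + 1)) :=
    (Nat.Coprime.pow_right _ ((Nat.Prime.coprime_iff_not_dvd hp.out).mpr hu).symm)
  have hlt : 1 < p ^ (k + j + 1) := Nat.one_lt_pow (Nat.succ_ne_zero _) hp.out.one_lt
  obtain ⟨u', -, hu'⟩ := Nat.exists_mul_mod_eq_one_of_coprime hcop hlt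
  obtain ⟨c, hc⟩ : ∃ c : ℕ, u * u' = p ^ (k + j + 1) * c + 1 := by
    refine ⟨u * u' / p ^ (k + j + 1), ?_⟩
    have h := Nat.div_add_mod (u * u') (p ^ (k + j + 1))
    rw [hu'] at h
    exact h.symm
  refine ⟨j, u' • m, u' • R - (p * c) • (p ^ j • a), u' • t, fun τ hτ ↦ ?_, fun τ hτ ↦ ?_, ⟨e, ?_⟩, ?_⟩
  · rw [galois_smul_nsmul, hm τ hτ]
  · rw [smul_sub, galois_smul_nsmul, hR τ hτ, galois_smul_nsmul, galois_smul_nsmul, ha τ hτ]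
  · rw [smul_comm, hte, smul_zero]
  · -- `p^j a = (u u') p^j a − (p^(k+j+1) c) p^j a`
    have h1 : u' • (p ^ j • (u • a)) = (u * u') • (p ^ j • a) := by
      rw [mul_comm, mul_smul, smul_comm u (p ^ j) a]
    have h2 : (u * u') • (p ^ j • a) = (p ^ (k + j + 1) * c) • (p ^ j • a) + p ^ j • a := by
      rw [hc, add_smul, one_smul]
    have h3 : (p ^ (k + j + 1) * c) • (p ^ j • a) = p ^ (k + j) • ((p * c) • (p ^ j • a)) := by
      rw [← mul_smul (p ^ (k + j)) (p * c), pow_succ, mul_assoc]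
    have h4 : u' • (p ^ j • (u • a)) = u' • (g • m - m) + p ^ (k + j) • (u' • R) + u' • t := by
      rw [heq, smul_add, smul_add, smul_comm u' (p ^ (k + j)) R]
    calc p ^ j • a = u' • (p ^ j • (u • a)) - p ^ (k + j) • ((p * c) • (p ^ j • a)) := by
          rw [h1, h2, h3]; abel
      _ = (g • (u' • m) - u' • m) + p ^ (k + j) • (u' • R - (p * c) • (p ^ j • a)) + u' • t := by
          rw [h4, smul_sub u', galois_smul_nsmul, smul_sub (p ^ (k + j))]; abel

omit [W.IsElliptic] hp in
/-- **(H²) at depth `k + s` for `p^s • a` gives (H²) at depth `k` for `a`** (with `j + s` in place of `j`).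
[cite: GreenbergLNM1716, §4 p. 108] -/
theorem coinvInput_of_pow_nsmul (N : Subgroup (absoluteGaloisGroup (v.adicCompletion K)))
    (g : absoluteGaloisGroup (v.adicCompletion K)) (a : localPoints W (v.adicCompletion K)) (k s : ℕ)
    (h : ∃ (j : ℕ) (m R t : localPoints W (v.adicCompletion K)),
      (∀ τ ∈ N, τ • m = m) ∧ (∀ τ ∈ N, τ • R = R) ∧ (∃ e : ℕ, p ^ e • t = 0) ∧
      p ^ j • (p ^ s • a) = (g • m - m) + p ^ (k + s + j) • R + t) :
    ∃ (j : ℕ) (m R t : localPoints W (v.adicCompletion K)),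
      (∀ τ ∈ N, τ • m = m) ∧ (∀ τ ∈ N, τ • R = R) ∧ (∃ e : ℕ, p ^ e • t = 0) ∧
      p ^ j • a = (g • m - m) + p ^ (k + j) • R + t := by
  obtain ⟨j, m, R, t, hm, hR, ht, heq⟩ := h
  refine ⟨j + s, m, R, t, hm, hR, ht, ?_⟩
  rw [pow_add, mul_smul, heq, show k + (j + s) = k + s + j by ring]

/-! ## §2 The core: (H²) on `M ∩ E₁` from `H²(K_v, C) = 0` and Coates–Greenberg -/

omit [W.IsElliptic] in
set_option maxHeartbeats 3200000 in
/-- **(H²) for `a ∈ E(K̄_v)^N ∩ E₁`, through the maps `λ_v`.** Setting: `K` a number field, `v` a finite place, `W/K`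
elliptic, `κE` a `ℤ_p`-extension of `K_v` with kernel `N` and topological generator `g`; `red₀ : E(K̄_v) →+ B` additive with
`Γ_{K_v}`-stable (`hstab`) and `p`-divisible (`hdiv₁`) kernel `E₁`; `C = E₁ ∩ E(K̄_v)[p^∞]` (`hC`) with a continuous
representation `ρ` of `Γ_{K_v}` acting as Galois (`hρ`) and **`H²(Γ_{K_v}, C) = 0`** (`hH2`); and the Coates–Greenberg
vanishing **`H¹(N, E₁) = 0`** in cocycle form (`hCG`). Then for every `a ∈ E₁` fixed by `N` and every `k` there are `j`,
`N`-fixed `m, R` with `p^j a = (g m − m) + p^{k+j} R`. Proof in the module docstring (Kummer cocycle of `a` in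
`H¹(N, C)`; Hochschild–Serre `exists_conjMap_sub_eq_of_resSubgroup_two_injective`; `ψ = ∂e` by Coates–Greenberg).
[cite: GreenbergLNM1716, §2 Props. 2.2–2.4 (pp. 72–75) and §4 p. 108] [cite: CoatesGreenberg1996, Cor. 3.2 and Prop. 4.3]
[cite: NeukirchSchmidtWingberg2008, (2.4.1)] -/
theorem coinvInput_of_mem_ker (κE : ZpExtension (v.adicCompletion K) p)
    {g : absoluteGaloisGroup (v.adicCompletion K)} (hγ : κE.IsTopGenerator g)
    {B : Type*} [AddCommGroup B] (red₀ : localPoints W (v.adicCompletion K) →+ B)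
    (hstab : ∀ (σ : absoluteGaloisGroup (v.adicCompletion K)) (Q : localPoints W (v.adicCompletion K)),
      red₀ Q = 0 → red₀ (σ • Q) = 0)
    (hdiv₁ : ∀ a : localPoints W (v.adicCompletion K), red₀ a = 0 →
      ∃ b : localPoints W (v.adicCompletion K), red₀ b = 0 ∧ p • b = a)
    (C : AddSubgroup (localPoints W (v.adicCompletion K)))
    (hC : ∀ a, a ∈ C ↔ red₀ a = 0 ∧ ∃ e : ℕ, p ^ e • a = 0)
    (ρ : ContinuousRep (absoluteGaloisGroup (v.adicCompletion K)) ℤ C)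
    (hρ : ∀ (σ : absoluteGaloisGroup (v.adicCompletion K)) (c : C),
      ((ρ σ c : C) : localPoints W (v.adicCompletion K)) = σ • (c : localPoints W (v.adicCompletion K)))
    (hH2 : Subsingleton (continuousCohomology 2 ρ.toTopRep))
    (hCG : ∀ ψ : contOneCocycles (discreteTopRep κE.kerSubgroup (localPoints W (v.adicCompletion K))),
      (∀ τ, red₀ (ψ.1 τ) = 0) →
        ∃ e : localPoints W (v.adicCompletion K), red₀ e = 0 ∧
          ∀ τ : κE.kerSubgroup, ψ.1 τ = (τ : absoluteGaloisGroup (v.adicCompletion K)) • e - e)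
    (a : localPoints W (v.adicCompletion K)) (ha0 : red₀ a = 0) (ha : ∀ τ ∈ κE.kerSubgroup, τ • a = a) (k : ℕ) :
    ∃ (j : ℕ) (m R t : localPoints W (v.adicCompletion K)),
      (∀ τ ∈ κE.kerSubgroup, τ • m = m) ∧ (∀ τ ∈ κE.kerSubgroup, τ • R = R) ∧ (∃ e : ℕ, p ^ e • t = 0) ∧
      p ^ j • a = (g • m - m) + p ^ (k + j) • R + t := by
  -- notation and instances
  let E := v.adicCompletion K
  let Pt : Type u := localPoints W E
  let Γ := absoluteGaloisGroup E
  let N : Subgroup Γ := κE.kerSubgroup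
  haveI : CompactSpace Γ := absoluteGaloisGroup_compactSpace E
  haveI : T2Space Γ := krullTopology_t2
  haveI hNc : IsClosed ((κE.kerSubgroup : Subgroup Γ) : Set Γ) := κE.isClosed_kerSubgroup
  haveI : CompactSpace κE.kerSubgroup := isCompact_iff_compactSpace.mp hNc.isCompact
  have galois_smul_nsmul : ∀ (τ : Γ) (n : ℕ) (P : Pt), τ • (n • P) = n • (τ • P) :=
    fun τ n P ↦ map_nsmul (DistribSMul.toAddMonoidHom Pt τ) n P
  have hprim : IsPrimaryTorsion p C := fun c ↦ by
    obtain ⟨-, e, he⟩ := (hC c).mp c.2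
    exact ⟨e, Subtype.ext (by rw [AddSubgroupClass.coe_nsmul, he, ZeroMemClass.coe_zero])⟩
  -- iterated `p`-divisibility of `E₁`
  have hdivpow : ∀ (i : ℕ) (x : Pt), red₀ x = 0 → ∃ y : Pt, red₀ y = 0 ∧ p ^ i • y = x := by
    intro i
    induction i with
    | zero => exact fun x hx ↦ ⟨x, hx, by rw [pow_zero, one_smul]⟩
    | succ i ih =>
      intro x hx
      obtain ⟨y, hy, rfl⟩ := hdiv₁ x hx
      obtain ⟨z, hz, rfl⟩ := ih y hy
      exact ⟨z, hz, by rw [pow_succ, mul_comm, mul_smul]⟩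
  -- `b ∈ E₁` with `p^k b = a`; the Kummer cocycle `s(τ) = τ b − b` with values in `C`
  obtain ⟨b, hb0, hba⟩ := hdivpow k a ha0
  have hsmem : ∀ τ : κE.kerSubgroup, (τ : Γ) • b - b ∈ C := fun τ ↦ by
    refine (hC _).mpr ⟨?_, k, ?_⟩
    · rw [map_sub, hstab _ b hb0, hb0, sub_zero]
    · rw [smul_sub, ← galois_smul_nsmul, hba, ha τ τ.2, sub_self]
  have hscont : Continuous fun τ : κE.kerSubgroup ↦ (⟨(τ : Γ) • b - b, hsmem τ⟩ : C) :=
    ((continuous_of_discreteTopology (f := fun q : Pt ↦ q - b)).comp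
      ((continuous_smul_localPoints W E b).comp continuous_subtype_val)).subtype_mk _
  have hρN : ∀ (τ : κE.kerSubgroup) (c : C),
      (((subgroupRep ρ.toTopRep κE.kerSubgroup).ρ τ c : C) : Pt) = (τ : Γ) • (c : Pt) := fun τ c ↦ hρ τ c
  let s : contOneCocycles (subgroupRep ρ.toTopRep κE.kerSubgroup) :=
    ⟨⟨fun τ ↦ ⟨(τ : Γ) • b - b, hsmem τ⟩, hscont⟩, fun σ τ ↦ by
      apply Subtype.ext
      rw [AddSubgroup.coe_add, hρN]
      change ((σ : Γ) * (τ : Γ)) • b - b = ((σ : Γ) • b - b) + (σ : Γ) • ((τ : Γ) • b - b)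
      rw [mul_smul, smul_sub]
      abel⟩
  have hs : ∀ τ : κE.kerSubgroup, ((s.1 τ : C) : Pt) = (τ : Γ) • b - b := fun _ ↦ rfl
  -- Hochschild–Serre: `[s] = g·[ψ] − [ψ]` in `H¹(N, C)`
  have hinj : ∀ x : continuousCohomology 2 ρ.toTopRep, resSubgroup ρ.toTopRep κE.kerSubgroup 2 x = 0 → x = 0 :=
    fun x _ ↦ Subsingleton.elim _ _
  obtain ⟨tc, htc⟩ := exists_conjMap_sub_eq_of_resSubgroup_two_injective κE.toContinuousMonoidHom κE.kerSubgroup ρ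
    κE.surjective (fun _ ↦ ZpExtension.mem_kerSubgroup) hγ (groupCdLE_one_quotient_kerSubgroup κE) hprim hinj
    (oneCocycleClass _ s)
  obtain ⟨ψ, rfl⟩ := oneCocycleClass_surjective _ tc
  rw [conjMap_oneCocycleClass, ← oneCocycleClass_sub, ← sub_eq_zero, ← oneCocycleClass_sub,
    oneCocycleClass_eq_zero_iff] at htc
  obtain ⟨c₀, hc₀⟩ := htc
  have hc₀' : ∀ τ : κE.kerSubgroup,
      g • (((ψ.1 (subgroupConj κE.kerSubgroup g τ) : C) : Pt)) - ((ψ.1 τ : C) : Pt) - ((τ : Γ) • b - b) =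
        (τ : Γ) • (c₀ : Pt) - c₀ := by
    intro τ
    have h := congrArg (fun x : C ↦ (x : Pt)) (hc₀ τ)
    simp only [ContinuousMap.sub_apply, AddSubgroupClass.coe_sub] at h
    rw [hρN, hs] at h
    rw [← hρ]
    exact h
  -- a uniform exponent killing `ψ` and `c₀`
  obtain ⟨Nψ, hNψ⟩ := exists_pow_smul_apply_eq_zero (p := p) ψ.1 (fun τ ↦ hprim _)
  obtain ⟨e₀, he₀⟩ := hprim c₀
  -- Coates–Greenberg: `ψ = ∂e` with `e ∈ E₁`
  let ψ' : contOneCocycles (discreteTopRep κE.kerSubgroup Pt) :=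
    ⟨⟨fun τ ↦ ((ψ.1 τ : C) : Pt), continuous_subtype_val.comp ψ.1.continuous⟩, fun σ τ ↦ by
      change ((ψ.1 (σ * τ) : C) : Pt) = ((ψ.1 σ : C) : Pt) + (σ : Γ) • ((ψ.1 τ : C) : Pt)
      rw [ψ.2 σ τ, AddSubgroup.coe_add, hρN]⟩
  have hψ' : ∀ τ, ψ'.1 τ = ((ψ.1 τ : C) : Pt) := fun _ ↦ rfl
  obtain ⟨e, he0, he⟩ := hCG ψ' (fun τ ↦ ((hC _).mp (ψ.1 τ).2).1)
  -- `R' = b + c₀ − (g e − e)` is fixed by `N`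
  have hconj_smul : ∀ τ : κE.kerSubgroup, g • (((subgroupConj κE.kerSubgroup g τ : κE.kerSubgroup) : Γ) • e) =
      (τ : Γ) • g • e := fun τ ↦ by
    rw [subgroupConj_apply_coe, ← mul_smul, ← mul_smul, ← mul_assoc, ← mul_assoc, mul_inv_cancel, one_mul]
  have hR' : ∀ τ ∈ κE.kerSubgroup, τ • (b + (c₀ : Pt) - (g • e - e)) = b + (c₀ : Pt) - (g • e - e) := by
    intro τ hτ
    have h := hc₀' ⟨τ, hτ⟩
    rw [← hψ', ← hψ', he, he, smul_sub g, hconj_smul] at h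
    rw [← sub_eq_zero]
    rw [← sub_eq_zero] at h
    rw [smul_sub τ, smul_add τ, smul_sub τ]
    change τ • g • e - g • e - (τ • e - e) - (τ • b - b) - (τ • (c₀ : Pt) - c₀) = 0 at h
    calc τ • b + τ • (c₀ : Pt) - (τ • g • e - τ • e) - (b + (c₀ : Pt) - (g • e - e))
        = -(τ • g • e - g • e - (τ • e - e) - (τ • b - b) - (τ • (c₀ : Pt) - c₀)) := by abel
      _ = 0 := by rw [h, neg_zero]
  -- `m = p^K e` is fixed by `N` for `K = k + (Nψ + e₀)`
  have hm : ∀ τ ∈ κE.kerSubgroup, τ • ((p ^ (k + (Nψ + e₀))) • e) = (p ^ (k + (Nψ + e₀))) • e := by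
    intro τ hτ
    have h1 : p ^ Nψ • (τ • e - e) = 0 := by
      have h := congrArg (fun x : C ↦ (x : Pt)) (hNψ ⟨τ, hτ⟩)
      simp only [AddSubgroupClass.coe_nsmul, ZeroMemClass.coe_zero] at h
      rw [← hψ', he] at h
      exact h
    rw [galois_smul_nsmul, ← sub_eq_zero, ← smul_sub, show k + (Nψ + e₀) = (k + e₀) + Nψ by ring, pow_add,
      mul_smul, h1, smul_zero]
  refine ⟨Nψ + e₀, (p ^ (k + (Nψ + e₀))) • e, b + (c₀ : Pt) - (g • e - e), 0, hm, hR', ⟨0, smul_zero _⟩, ?_⟩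
  -- multiply `R'` by `p^(k + Nψ + e₀)`
  have h1 : p ^ (k + (Nψ + e₀)) • b = p ^ (Nψ + e₀) • a := by
    rw [pow_add, mul_comm, mul_smul, hba]
  have h2 : p ^ (k + (Nψ + e₀)) • (c₀ : Pt) = 0 := by
    rw [show k + (Nψ + e₀) = (k + Nψ) + e₀ by ring, pow_add, mul_smul, ← AddSubgroupClass.coe_nsmul, he₀,
      ZeroMemClass.coe_zero, smul_zero]
  rw [add_zero, smul_sub (p ^ (k + (Nψ + e₀))), smul_add (p ^ (k + (Nψ + e₀))), h1, h2, add_zero,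
    smul_sub (p ^ (k + (Nψ + e₀))), galois_smul_nsmul]
  abel

/-! ## §3 (H²) on all of `M = E(K̄_v)^N` -/

omit [W.IsElliptic] in
set_option maxHeartbeats 800000 in
/-- **`(E(K_{∞,η}) ⊗ ℚ_p/ℤ_p)_{Γ_η} = 0` at a good ordinary `v ∣ p`, element-wise** — the hypothesis (H²) of
`Greenberg1999.exists_primary_resOfLe_eq_of_forall_conjH1_eq_of_coinv`, for the kernel `N` and a topological generator `g`
of a `ℤ_p`-extension `κE` of `K_v`, from: the ordinary `red₀`-package (`hstab`, `hdiv₁`, and `htor`: every point has a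
positive multiple in `E₁ = ker red₀`), `H²(Γ_{K_v}, C) = 0` for `C = E₁ ∩ E(K̄_v)[p^∞]` (`hH2`, step 1), and the
Coates–Greenberg vanishing `H¹(N, E₁) = 0` in cocycle form (`hCG`). For every `N`-fixed `a` and every `k` there are `j`,
`N`-fixed `m, R` and a `p`-power-torsion `t` with `p^j a = (g m − m) + p^{k+j} R + t`. (§2 for the multiple
`n a = p^s u a ∈ E₁`, then §1.) [cite: GreenbergLNM1716, §2 pp. 70–75 and §4 p. 108]
[cite: CoatesGreenberg1996, Cor. 3.2 and Prop. 4.3] -/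
theorem coinvInput_of_formalH2_of_coatesGreenberg (κE : ZpExtension (v.adicCompletion K) p)
    {g : absoluteGaloisGroup (v.adicCompletion K)} (hγ : κE.IsTopGenerator g)
    {B : Type*} [AddCommGroup B] (red₀ : localPoints W (v.adicCompletion K) →+ B)
    (hstab : ∀ (σ : absoluteGaloisGroup (v.adicCompletion K)) (Q : localPoints W (v.adicCompletion K)),
      red₀ Q = 0 → red₀ (σ • Q) = 0)
    (hdiv₁ : ∀ a : localPoints W (v.adicCompletion K), red₀ a = 0 →
      ∃ b : localPoints W (v.adicCompletion K), red₀ b = 0 ∧ p • b = a)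
    (htor : ∀ P : localPoints W (v.adicCompletion K), ∃ n : ℕ, 0 < n ∧ red₀ (n • P) = 0)
    (C : AddSubgroup (localPoints W (v.adicCompletion K)))
    (hC : ∀ a, a ∈ C ↔ red₀ a = 0 ∧ ∃ e : ℕ, p ^ e • a = 0)
    (ρ : ContinuousRep (absoluteGaloisGroup (v.adicCompletion K)) ℤ C)
    (hρ : ∀ (σ : absoluteGaloisGroup (v.adicCompletion K)) (c : C),
      ((ρ σ c : C) : localPoints W (v.adicCompletion K)) = σ • (c : localPoints W (v.adicCompletion K)))
    (hH2 : Subsingleton (continuousCohomology 2 ρ.toTopRep))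
    (hCG : ∀ ψ : contOneCocycles (discreteTopRep κE.kerSubgroup (localPoints W (v.adicCompletion K))),
      (∀ τ, red₀ (ψ.1 τ) = 0) →
        ∃ e : localPoints W (v.adicCompletion K), red₀ e = 0 ∧
          ∀ τ : κE.kerSubgroup, ψ.1 τ = (τ : absoluteGaloisGroup (v.adicCompletion K)) • e - e)
    (a : localPoints W (v.adicCompletion K)) (ha : ∀ τ ∈ κE.kerSubgroup, τ • a = a) (k : ℕ) :
    ∃ (j : ℕ) (m R t : localPoints W (v.adicCompletion K)),
      (∀ τ ∈ κE.kerSubgroup, τ • m = m) ∧ (∀ τ ∈ κE.kerSubgroup, τ • R = R) ∧ (∃ e : ℕ, p ^ e • t = 0) ∧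
      p ^ j • a = (g • m - m) + p ^ (k + j) • R + t := by
  have galois_smul_nsmul : ∀ (τ : absoluteGaloisGroup (v.adicCompletion K)) (n : ℕ)
      (P : localPoints W (v.adicCompletion K)), τ • (n • P) = n • (τ • P) :=
    fun τ n P ↦ map_nsmul (DistribSMul.toAddMonoidHom (localPoints W (v.adicCompletion K)) τ) n P
  -- a positive multiple `n a ∈ E₁`, `n = p^s u` with `p ∤ u`
  obtain ⟨n, hn, hna⟩ := htor a
  obtain ⟨s, u, hu, rfl⟩ := Nat.exists_eq_pow_mul_and_not_dvd hn.ne' p hp.out.ne_one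
  rw [mul_comm, mul_smul] at hna
  have hfix : ∀ τ ∈ κE.kerSubgroup, τ • (u • (p ^ s • a)) = u • (p ^ s • a) := fun τ hτ ↦ by
    rw [galois_smul_nsmul, galois_smul_nsmul, ha τ hτ]
  -- §2 for `u • (p^s • a)` at depth `k + s`, then §1
  have hcore := coinvInput_of_mem_ker v W κE hγ red₀ hstab hdiv₁ C hC ρ hρ hH2 hCG (u • (p ^ s • a)) hna hfix (k + s)
  exact coinvInput_of_pow_nsmul v W κE.kerSubgroup g a k s
    (coinvInput_of_nsmul_not_dvd v W κE.kerSubgroup g (p ^ s • a) (k + s) hu hcore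
      (fun τ hτ ↦ by rw [galois_smul_nsmul, ha τ hτ]))

end Summit.BirchSwinnertonDyer.BirchSwinnertonDyer.Theorems.InputsGreenbergLocalAtP

end
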